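/-
Copyright (c) 2026. Released under Apache 2.0 license.
-/
import Literature.NumberTheory.Automorphic.ModularParseval

/-!
# Corollary 12.2 of Iwaniec's *Spectral Methods*: the discharge `modularHyperbolicCount_asymp_holds`

Source: H. Iwaniec, *Spectral Methods of Automorphic Forms*, 2nd ed., AMS GSM 53 (2002),
Corollary 12.2, (12.12), PDF p. 126 (held copy `book:iwaniec2002-spectral-methods-automorphic-forms`):

> If `Γ` is the modular group, then `P(X) = 6X + O(X^{2/3})`,

where `P(X) = #{γ ∈ Γ : 4u(γz, w) + 2 ≤ X}` at `z = w = i` (display before Theorem 12.1).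

This file closes the named fact `modularHyperbolicCount_asymp` (`HyperbolicLatticeCount.lean`) by
assembling results already in the tree, following the printed one-line proof ("from Theorem 12.1
and Corollary 11.5"):

* `modularHyperbolicCount_asymp_of_thm_7_4 : Iwaniec2002_thm_7_4_modular → modularHyperbolicCount_asymp`
  (`ModularPretrace.lean`: (12.5) from Theorem 7.4 (7.17) with Proposition 7.2 (7.10) for `SL₂(ℤ)`,
  the test kernel `k_{X,Y}` with (12.7)–(12.9), `Y = X^{2/3}`, `|F| = π/3`, and the absence of
  exceptional spectrum for the modular group, Corollary 11.5);
* `Iwaniec2002_thm_7_4_modular_holds` (`ModularParseval.lean`: Theorem 7.4 for `SL₂(ℤ)` in datum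
  form, proved from the Parseval identity, Theorem 7.3 (7.15) with Theorem 4.7 and (3.26)).

No hypotheses, no new definitions, no new named facts.

## References
* [Iwaniec2002] H. Iwaniec, *Spectral Methods of Automorphic Forms*, 2nd ed., Graduate Studies in
  Mathematics 53, AMS 2002, Cor. 12.2 (12.12), PDF p. 126; Thm 7.4 (7.17), Prop. 7.2 (7.10), PDF
  pp. 73–76; Cor. 11.5, PDF p. 121.
-/

noncomputable section

namespace Literature.NumberTheory.Automorphic

/-- **Corollary 12.2 (Iwaniec), discharged.** For the modular group `Γ = SL₂(ℤ)` (its image `𝒮ℒ`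
in `GL₂(ℝ)`) and `z = w = i`, the hyperbolic lattice-point count satisfies
`P(X) = 6X + O(X^{2/3})` as `X → ∞` — equivalently (12.10)–(12.11): the number of integer points
on `ad - bc = 1` in the ball `a² + b² + c² + d² ≤ X` is `6X + O(X^{2/3})`. Proof as printed:
Theorem 12.1 (via Theorem 7.4 and Proposition 7.2 for `SL₂(ℤ)`, `Iwaniec2002_thm_7_4_modular_holds`)
and Corollary 11.5. [cite: Iwaniec2002, Cor. 12.2, (12.12), PDF p. 126] -/
theorem modularHyperbolicCount_asymp_holds : modularHyperbolicCount_asymp :=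
  modularHyperbolicCount_asymp_of_thm_7_4 Iwaniec2002_thm_7_4_modular_holds

end Literature.NumberTheory.Automorphic

end
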